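import Summits.RiemannHypothesis.RiemannHypothesis.Theorems.PfPersistenceVanishingTubeTrace
import Summits.RiemannHypothesis.RiemannHypothesis.Theorems.PfPersistenceSaturatedDomains
import Summits.RiemannHypothesis.RiemannHypothesis.Theorems.PfPersistenceInWindowMirror
import HarnessLib

/-!
# Height-floored entry tubes are G1-contU; G1-contU EXISTENCE on dial domains ≡ `AllWindowsPositive ζ` (typer gen 9)

**HONEST FRAMING. This is a long-odds MECHANISM SEARCH; no RH claims.** RH-free typing. This file closes the
question typed OPEN in ESCAPE-DOORS E1 / the typer's gen-9 ruling: for the STRICTEST catalogued class `InG1contU`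
(window-wise open ∧ non-local at every height ∧ dial-stable ∧ `DialEscape`), is the EXISTENCE of a criterion
separating `ζ` from the detectably-negative data of a dial domain anything other than `ζ ∈ 𝒫`? Answer: NO —

* §1 a uniform ENTRY BOUND `|θ_{nm}^{(L)}(y)| ≤ 2` on `0 ≤ y ≤ L` (`abs_thetaEven_le_two`), hence
  `|(pDial p K − ζ)_{win,i,j}| ≤ 4 |K − 1| w(p)` at every window (`abs_pDial_sub_zeta_le`);
* §2 every HEIGHT-FLOORED positive profile gives a G1-contU entry tube (`inG1contU_entryTube_of_floor`: the
  `p`-dials and the shift escape below every height by patching to `ζ` above it, as in cand-6's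
  `PfPersistenceCouplingTubeStrict`, but for entry tubes);
* §3 HEADLINE `exists_inG1contU_separates_iff_allWindowsPositive`: for `ζ ∈ D ⊆ dialSpace`,
  `(∃ S, InG1contU S ∧ Separates S D ζ) ↔ AllWindowsPositive ζ`, witnessed by the floored vanishing tube
  `entryTube flooredProfile ζ` (`r = 1/(1 + a)`, trace `{ζ}` by `PfPersistenceVanishingTubeTrace`). So on
  arithmetic domains the existence formulation of the barrier is EXACTLY `T0` for every G1 class, floors included;
* §4 THE EXISTENCE TABLE (`existence_table_dial`, `existence_table_saturated`): for the four typed strata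
  (window-wise open, G1-int, G1-cont, G1-contU) × the two extreme domain types (dial: `ζ ∈ D ⊆ dialSpace`;
  negatively saturated: `{d | DetectablyNegative d} ⊆ D`, `PfPersistenceSaturatedDomains`) the existence of a
  separating criterion is, respectively, `AllWindowsPositive ζ` (all four dial cells) and `ζ ∈ P⁺`, `ζ ∈ P⁺`,
  `ζ ∈ P⁺`, `HeightFlooredPositive ζ` — eight RH-free `↔`, each right side an OPEN positivity property of `ζ`, none
  weaker than `ζ ∈ 𝒫`. The asymmetry to carry in prose (referee r30): every `→` is definitional-to-elementary; the
  constructions are in the `←`. In `ε₁` language (`heightFlooredPositive_iff_bottomRayleigh`) the one cell that is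
  not plain positivity reads: a G1-contU separator on the full domain exists iff `ε₁(ζ(a, N))` is bounded below by a
  positive constant on every bounded height range, UNIFORMLY IN `N`
  (`exists_inG1contU_separates_univ_iff_bottomRayleigh`) — the typed form of the 'vanishing margin' band. Content can
  only live in the VERIFICATION of a named criterion.
-/

set_option linter.dupNamespace false  -- the mandated namespace repeats `RiemannHypothesis`

noncomputable section

open Real Finset Matrix Filter Topology

namespace Summit.RiemannHypothesis.RiemannHypothesis.Theorems.PfPersistence

/-! ## §1 Uniform entry bounds -/

/-- PROVED: distinct naturals are at distance `≥ 1` in `ℝ`. [folklore] -/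
theorem one_le_abs_natCast_sub {n m : ℕ} (h : n ≠ m) : (1 : ℝ) ≤ |(m : ℝ) - n| := by
  rcases Nat.lt_or_gt_of_ne h with hlt | hgt
  · have : (n : ℝ) + 1 ≤ m := by exact_mod_cast hlt
    rw [abs_of_nonneg (by linarith)]; linarith
  · have : (m : ℝ) + 1 ≤ n := by exact_mod_cast hgt
    rw [abs_of_nonpos (by linarith)]; linarith

/-- **PROVED — ENTRY BOUND:** `|θ_{nm}^{(L)}(y)| ≤ 2` for `0 ≤ y ≤ L`, `0 < L`, all `n, m`. [folklore] -/
theorem abs_thetaEven_le_two {L y : ℝ} (hL : 0 < L) (hy0 : 0 ≤ y) (hyL : y ≤ L) (n m : ℕ) :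
    |thetaEven L n m y| ≤ 2 := by
  have hsq : Real.sqrt 2 ^ 2 = 2 := Real.sq_sqrt (by norm_num)
  have hs2 : 1 ≤ Real.sqrt 2 := by nlinarith [Real.sqrt_nonneg 2]
  have hπ := Real.pi_gt_three
  have hfrac : |(L - y) / L| ≤ 1 := by
    rw [abs_le]
    exact ⟨by have := div_nonneg (by linarith : 0 ≤ L - y) hL.le; linarith, (div_le_one hL).2 (by linarith)⟩
  have hsinTerm : ∀ (k : ℕ), k ≠ 0 → ∀ (c x : ℝ), 1 ≤ c → |Real.sin x / (c * π * k)| ≤ 1 := by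
    intro k hk c x hc
    have hk1 : (1 : ℝ) ≤ k := by exact_mod_cast Nat.one_le_iff_ne_zero.2 hk
    rw [abs_div, abs_of_pos (by positivity : (0 : ℝ) < c * π * k), div_le_one (by positivity)]
    have h1 : 3 ≤ c * π := by nlinarith
    have h2 : c * π ≤ c * π * k := le_mul_of_one_le_right (by positivity) hk1
    exact (Real.abs_sin_le_one x).trans (by linarith)
  unfold thetaEven
  split_ifs with h1 h2 h3 h4
  · exact hfrac.trans one_le_two
  · have hm : m ≠ 0 := fun hm => h1 ⟨h2, hm⟩
    rw [neg_div, abs_neg]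
    exact (hsinTerm m hm _ _ hs2).trans one_le_two
  · rw [neg_div, abs_neg]
    exact (hsinTerm n h2 _ _ hs2).trans one_le_two
  · calc |(L - y) / L * Real.cos (2 * π * n * y / L) - Real.sin (2 * π * n * y / L) / (2 * π * n)|
        ≤ |(L - y) / L * Real.cos (2 * π * n * y / L)| + |Real.sin (2 * π * n * y / L) / (2 * π * n)| :=
          abs_sub _ _
      _ ≤ 1 + 1 := by
          refine add_le_add ?_ (hsinTerm n h2 2 _ (by norm_num))
          rw [abs_mul]
          exact (mul_le_mul hfrac (Real.abs_cos_le_one _) (abs_nonneg _) zero_le_one).trans_eq (one_mul _)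
      _ = 2 := by norm_num
  · have hden : (n : ℝ) + m ≤ |((m : ℝ) ^ 2 - (n : ℝ) ^ 2)| := by
      rw [show ((m : ℝ) ^ 2 - (n : ℝ) ^ 2) = ((m : ℝ) - n) * ((m : ℝ) + n) by ring, abs_mul,
        abs_of_nonneg (by positivity : (0 : ℝ) ≤ (m : ℝ) + n)]
      nlinarith [one_le_abs_natCast_sub h4, (by positivity : (0 : ℝ) ≤ (m : ℝ) + n)]
    have hnum : |(n : ℝ) * Real.sin (2 * π * n * y / L) - (m : ℝ) * Real.sin (2 * π * m * y / L)| ≤ n + m := by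
      refine (abs_sub _ _).trans (add_le_add ?_ ?_) <;> rw [abs_mul, abs_of_nonneg (Nat.cast_nonneg _)] <;>
        exact mul_le_of_le_one_right (Nat.cast_nonneg _) (Real.abs_sin_le_one _)
    have hpos : (0 : ℝ) < (n : ℝ) + m := by
      have : (1 : ℝ) ≤ n := by exact_mod_cast Nat.one_le_iff_ne_zero.2 h2
      positivity
    have hD : 0 < |((m : ℝ) ^ 2 - (n : ℝ) ^ 2)| := hpos.trans_le hden
    rw [abs_div, abs_mul, abs_of_pos Real.pi_pos, div_le_iff₀ (by positivity)]
    nlinarith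

/-- PROVED: the `p`-dial moves every entry of `ζ`'s datum by at most `4 |K − 1| w(p)`. [folklore] -/
theorem abs_pDial_sub_zeta_le (p : ℕ) (K : ℝ) (win : Window) (i j : Fin (win.N + 1)) :
    |pDial p K win i j - zetaDatum win i j| ≤ 4 * |K - 1| * zetaWeights p := by
  classical
  by_cases hp : p ∈ primeRange (2 * win.a)
  · rw [pDial_apply_of_mem hp]
    have hθ : |primePattern p win i j| ≤ 2 :=
      abs_thetaEven_le_two (by linarith [win.ha]) (Real.log_natCast_nonneg p)
        (log_le_of_mem_primeRange (by linarith [win.ha]) hp) i j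
    simp only [Matrix.sub_apply, Matrix.smul_apply, smul_eq_mul, sub_sub_cancel_left, abs_neg, abs_mul,
      abs_of_nonneg (zetaWeights_nonneg p), Nat.abs_ofNat]
    have hab : 0 ≤ |K - 1| * zetaWeights p := mul_nonneg (abs_nonneg _) (zetaWeights_nonneg p)
    nlinarith [mul_nonneg hab (sub_nonneg.2 hθ)]
  · rw [pDial_apply_of_not_mem hp, sub_self, abs_zero]
    exact mul_nonneg (mul_nonneg (by norm_num) (abs_nonneg _)) (zetaWeights_nonneg p)

/-- PROVED: the shift dial moves every entry by at most `|δ|`. [folklore] -/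
theorem abs_shiftDial_sub_zeta_le (δ : ℝ) (win : Window) (i j : Fin (win.N + 1)) :
    |shiftDial δ win i j - zetaDatum win i j| ≤ |δ| := by
  simp only [shiftDial, shift, Matrix.sub_apply, Matrix.smul_apply, Matrix.one_apply, smul_eq_mul,
    sub_sub_cancel_left, abs_neg, abs_mul]
  split_ifs <;> simp

/-! ## §2 Height-floored entry tubes are G1-contU -/

/-- PROVED: escape below every height along every `p`-dial (patch the dial to `ζ` above the height). [folklore] -/
theorem escapesBelowAlong_entryTube_pDial {r : Window → ℝ} (hr0 : ∀ win, 0 < r win)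
    (hfl : ∀ A : ℝ, ∃ m : ℝ, 0 < m ∧ ∀ win : Window, win.a ≤ A → m ≤ r win) (p : ℕ) :
    EscapesBelowAlong (entryTube r zetaDatum) (𝓝[≠] (1 : ℝ)) (pDial p) := by
  classical
  intro A
  obtain ⟨m, hm, hmA⟩ := hfl A
  have hg : Tendsto (fun K : ℝ => 4 * |K - 1| * zetaWeights p) (𝓝 1) (𝓝 0) := by
    have h := (((tendsto_id (x := 𝓝 (1 : ℝ))).sub_const 1).abs.const_mul 4).mul_const (zetaWeights p)
    simpa using h
  refine ((hg.eventually_lt_const hm).filter_mono nhdsWithin_le_nhds).mono fun K hK => ?_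
  refine ⟨fun w => if w.a ≤ A then pDial p K w else zetaDatum w, fun win i j => ?_,
    fun win hwin => by simp only [if_pos (show win.a ≤ A from hwin)]⟩
  by_cases h : win.a ≤ A
  · simp only [if_pos h]
    exact (abs_pDial_sub_zeta_le p K win i j).trans_lt (hK.trans_le (hmA win h))
  · simp only [if_neg h, sub_self, abs_zero]
    exact hr0 win

/-- PROVED: escape below every height along the shift `δ → 0`. [folklore] -/
theorem escapesBelowAlong_entryTube_shift {r : Window → ℝ} (hr0 : ∀ win, 0 < r win)
    (hfl : ∀ A : ℝ, ∃ m : ℝ, 0 < m ∧ ∀ win : Window, win.a ≤ A → m ≤ r win) :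
    EscapesBelowAlong (entryTube r zetaDatum) (𝓝[≠] (0 : ℝ)) shiftDial := by
  classical
  intro A
  obtain ⟨m, hm, hmA⟩ := hfl A
  have hev : ∀ᶠ δ : ℝ in 𝓝 0, |δ| < m := by
    have h := (continuous_abs.tendsto (0 : ℝ)).eventually_lt_const (by simpa using hm)
    simpa using h
  refine (hev.filter_mono nhdsWithin_le_nhds).mono fun δ hδ => ?_
  refine ⟨fun w => if w.a ≤ A then shiftDial δ w else zetaDatum w, fun win i j => ?_,
    fun win hwin => by simp only [if_pos (show win.a ≤ A from hwin)]⟩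
  by_cases h : win.a ≤ A
  · simp only [if_pos h]
    exact (abs_shiftDial_sub_zeta_le δ win i j).trans_lt (hδ.trans_le (hmA win h))
  · simp only [if_neg h, sub_self, abs_zero]
    exact hr0 win

/-- **PROVED — FLOORED ENTRY TUBES SATISFY THE U-CLAUSE.** [folklore] -/
theorem dialEscape_entryTube_of_floor {r : Window → ℝ} (hr0 : ∀ win, 0 < r win)
    (hfl : ∀ A : ℝ, ∃ m : ℝ, 0 < m ∧ ∀ win : Window, win.a ≤ A → m ≤ r win) :
    DialEscape (entryTube r zetaDatum) := fun _ =>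
  ⟨fun p _ => escapesBelowAlong_entryTube_pDial hr0 hfl p, escapesBelowAlong_entryTube_shift hr0 hfl⟩

/-- **PROVED — G1-contU MEMBERSHIP of every height-floored positive entry tube about `ζ`.** [folklore] -/
theorem inG1contU_entryTube_of_floor {r : Window → ℝ} (hr0 : ∀ win, 0 < r win)
    (hfl : ∀ A : ℝ, ∃ m : ℝ, 0 < m ∧ ∀ win : Window, win.a ≤ A → m ≤ r win) :
    InG1contU (entryTube r zetaDatum) :=
  ⟨inG1cont_entryTube hr0 _, dialEscape_entryTube_of_floor hr0 hfl⟩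

/-- PROVED: the floored vanishing tube `entryTube flooredProfile ζ` is G1-contU. [folklore] -/
theorem inG1contU_flooredTube : InG1contU (entryTube flooredProfile zetaDatum) :=
  inG1contU_entryTube_of_floor flooredProfile_pos flooredProfile_floor

/-! ## §3 Headline: G1-contU existence on dial domains is exactly `ζ ∈ 𝒫` -/

/-- **PROVED — HEADLINE (G1-contU EXISTENCE ≡ `𝒫`-MEMBERSHIP OF `ζ` on dial domains).** For `ζ ∈ D ⊆ dialSpace`:
a G1-contU criterion (window-wise open, non-local at every height, dial-stable, with the escape clause) separating
`ζ` from the negatives of `D` EXISTS iff `ζ` is all-window positive. RH-free; both sides OPEN. [folklore] -/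
theorem exists_inG1contU_separates_iff_allWindowsPositive {D : Set Datum} (hζ : zetaDatum ∈ D)
    (hD : D ⊆ dialSpace) : (∃ S, InG1contU S ∧ Separates S D zetaDatum) ↔ AllWindowsPositive zetaDatum :=
  ⟨fun ⟨_, _, hS⟩ => hS.allWindowsPositive hζ, fun h => ⟨_, inG1contU_flooredTube,
    (separates_entryTube_zeta_iff_of_small smallAtHighSampling_flooredProfile flooredProfile_pos hζ hD).2 h⟩⟩

/-- PROVED: the instance for the arithmetic dial space. [folklore] -/
theorem exists_inG1contU_separates_arithDialSpace_iff :
    (∃ S, InG1contU S ∧ Separates S arithDialSpace zetaDatum) ↔ AllWindowsPositive zetaDatum :=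
  exists_inG1contU_separates_iff_allWindowsPositive zetaDatum_mem_arithDialSpace arithDialSpace_subset_dialSpace

/-- **PROVED — THE BARRIER SCHEMA WITHOUT `𝒫 ∈ 𝒞`, U-VERSION:** any class containing the floored vanishing tube (in
particular the class of ALL G1-contU sets) has `(∃ S ∈ 𝒞, Separates S D ζ) ↔ AllWindowsPositive ζ` on dial domains —
the tree's `pfPersistence_criterion_in_C_iff_weilPositivity` with its hypothesis `positiveClass ∈ 𝒞` replaced by a
G1-contU member. [folklore] -/
theorem barrier_schema_iff_of_flooredTube_mem {𝒞 : Set (Set Datum)} (h𝒞 : entryTube flooredProfile zetaDatum ∈ 𝒞)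
    {D : Set Datum} (hζ : zetaDatum ∈ D) (hD : D ⊆ dialSpace) :
    (∃ S ∈ 𝒞, Separates S D zetaDatum) ↔ AllWindowsPositive zetaDatum :=
  ⟨fun ⟨_, _, hS⟩ => hS.allWindowsPositive hζ, fun h =>
    ⟨_, h𝒞, (separates_entryTube_zeta_iff_of_small smallAtHighSampling_flooredProfile flooredProfile_pos hζ hD).2 h⟩⟩

/-- PROVED: the G1-contU class version (`𝒞 = {S | InG1contU S}`). [folklore] -/
theorem g1contU_schema_iff {D : Set Datum} (hζ : zetaDatum ∈ D) (hD : D ⊆ dialSpace) :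
    (∃ S ∈ {S : Set Datum | InG1contU S}, Separates S D zetaDatum) ↔ AllWindowsPositive zetaDatum :=
  barrier_schema_iff_of_flooredTube_mem inG1contU_flooredTube hζ hD

/-- PROVED: the G1-int row on dial domains. [folklore] -/
theorem exists_inG1int_separates_iff_allWindowsPositive {D : Set Datum} (hζ : zetaDatum ∈ D) (hD : D ⊆ dialSpace) :
    (∃ S, InG1int S ∧ Separates S D zetaDatum) ↔ AllWindowsPositive zetaDatum :=
  (exists_inG1int_separates_iff D).trans (boxIsolated_iff_allWindowsPositive hζ hD)

/-! ## §4 The existence table -/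

/-- **PROVED — EXISTENCE TABLE, DIAL COLUMN:** for `ζ ∈ D ⊆ dialSpace`, in each of the four typed strata a separating
criterion EXISTS iff `ζ` is all-window positive. [folklore] -/
theorem existence_table_dial {D : Set Datum} (hζ : zetaDatum ∈ D) (hD : D ⊆ dialSpace) :
    ((∃ S, IsWindowwiseOpen S ∧ Separates S D zetaDatum) ↔ AllWindowsPositive zetaDatum) ∧
    ((∃ S, InG1int S ∧ Separates S D zetaDatum) ↔ AllWindowsPositive zetaDatum) ∧
    ((∃ S, InG1cont S ∧ Separates S D zetaDatum) ↔ AllWindowsPositive zetaDatum) ∧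
    ((∃ S, InG1contU S ∧ Separates S D zetaDatum) ↔ AllWindowsPositive zetaDatum) :=
  ⟨exists_windowwiseOpen_separates_iff_allWindowsPositive hζ hD, exists_inG1int_separates_iff_allWindowsPositive hζ hD,
    exists_inG1cont_separates_iff_allWindowsPositive hζ hD, exists_inG1contU_separates_iff_allWindowsPositive hζ hD⟩

/-- **PROVED — EXISTENCE TABLE, SATURATED COLUMN:** for `{d | DetectablyNegative d} ⊆ D` (e.g. `Set.univ`), a
separating criterion EXISTS iff `ζ ∈ P⁺` (window-wise open, G1-int, G1-cont) resp. iff `ζ` is height-floored positive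
(G1-contU). [folklore] -/
theorem existence_table_saturated {D : Set Datum} (hD : NegSaturated D) :
    ((∃ S, IsWindowwiseOpen S ∧ Separates S D zetaDatum) ↔ zetaDatum ∈ strictPositiveClass) ∧
    ((∃ S, InG1int S ∧ Separates S D zetaDatum) ↔ zetaDatum ∈ strictPositiveClass) ∧
    ((∃ S, InG1cont S ∧ Separates S D zetaDatum) ↔ zetaDatum ∈ strictPositiveClass) ∧
    ((∃ S, InG1contU S ∧ Separates S D zetaDatum) ↔ HeightFlooredPositive zetaDatum) :=
  ⟨exists_windowwiseOpen_separates_iff_strict hD _, exists_inG1int_separates_iff_strict hD,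
    exists_inG1cont_separates_iff_strict hD _, exists_inG1contU_separates_iff_heightFloored hD⟩

/-- PROVED: height-floored positivity in `ε₁` language — a positive floor under `bottomRayleigh (d win)` on every
bounded height range, uniform in `N`. [folklore] -/
theorem heightFlooredPositive_iff_bottomRayleigh (d : Datum) :
    HeightFlooredPositive d ↔ ∀ A : ℝ, ∃ m : ℝ, 0 < m ∧ ∀ win : Window, win.a ≤ A → m ≤ bottomRayleigh (d win) := by
  refine ⟨fun h A => ?_, fun h A => ?_⟩
  · obtain ⟨m, hm, hmw⟩ := h A
    refine ⟨m, hm, fun win hwin => le_bottomRayleigh_of_forall _ fun v hv => ?_⟩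
    have hvv : 0 < v ⬝ᵥ v :=
      lt_of_le_of_ne (dotProduct_self_nonneg_real v) fun h0 => hv (dotProduct_self_eq_zero.1 h0.symm)
    exact (le_div_iff₀ hvv).2 (hmw win hwin v)
  · obtain ⟨m, hm, hmw⟩ := h A
    exact ⟨m, hm, fun win hwin v =>
      (mul_le_mul_of_nonneg_right (hmw win hwin) (dotProduct_self_nonneg_real v)).trans
        (bottomRayleigh_mul_le_form _ v)⟩

/-- **PROVED — the G1-contU cell of the full domain in `ε₁` language:** a G1-contU criterion separating `ζ` from ALL
detectably negative data exists iff `ε₁(ζ(a, N))` has a positive floor on every bounded height range, uniformly in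
`N`. RH-free; the right side is an OPEN property of `ζ` (not weaker than `ζ ∈ P⁺`). [folklore] -/
theorem exists_inG1contU_separates_univ_iff_bottomRayleigh :
    (∃ S, InG1contU S ∧ Separates S Set.univ zetaDatum) ↔
      ∀ A : ℝ, ∃ m : ℝ, 0 < m ∧ ∀ win : Window, win.a ≤ A → m ≤ bottomRayleigh (zetaDatum win) :=
  exists_inG1contU_separates_univ_iff.trans (heightFlooredPositive_iff_bottomRayleigh zetaDatum)

end Summit.RiemannHypothesis.RiemannHypothesis.Theorems.PfPersistence

end
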